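import Summits.BirchSwinnertonDyer.BirchSwinnertonDyer.Theorems.PrintX9MuPartSpecWitnessDefs
import Literature.NumberTheory.EllipticCurves.IwasawaAlgebraEisensteinQuotientTorsionProofs
import Literature.NumberTheory.EllipticCurves.CharacterModuleDivisibleTorsionProofs
import HarnessLib

/-!
# A `SpecWitness` at `q_m` from S1 (control) and S2 in Howard's printed shape `H¹_𝓕(K, A_𝔮) ≅ 𝒟 ⊕ M ⊕ M` —
# the ADDITIVE-currency companion of `PrintX9MuPartSpecWitnessOfHowardShape` (proofs file)

Cell `pub/bsd-print-x9`, seat `bsd-line-x9-p1-w2` (g5). THEOREMS ONLY; no definition, no named fact, no `sorry`;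
ROUTE-INDEPENDENT (imports no `Theses` file). Namespace of the shared letters / witness interface
(`Summit.BirchSwinnertonDyer.BirchSwinnertonDyer.Theorems.HeegnerMuPartStabilized`; files `PrintX9MuPartSpecWitnessDefs`
p632362, `PrintX9MuPartStabilizedOfSpecWitnesses` p633080, `PrintX9MuPartSpecWitnessOfDVRData` p635135).

WHY THIS COMPANION (v9-plan ADDENDUM v2, STUB 4 «glue currency»): the sibling file `PrintX9MuPartSpecWitnessOfHowardShape`
(x9-p1 LEAD g3, p638335: `nonempty_specWitness_of_howardShape`) takes Howard's conclusion as an `S_m`-LINEAR isomorphism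
`𝒜 ≃ₗ[S_m] 𝒟 × (M × M)` with `𝒟` divisible by `S_m⁰`; the tree's typing of the cited theorem
(`Howard2004.DVRSetting.Conclusion`, file `Howard2004/DVRKolyvaginBound.lean`, p642393) delivers an ADDITIVE bijection
`Φ : H¹_F(K,A) ≃+ FracModR R × (M × M)` (equivariant on representatives). The theorems below take exactly additive data —
`eX : Xq ≃+ Hom(B, ℚ/ℤ)`, `eB : B ≃+ D × (M × M)`, `D` divisible by the natural numbers — so no `S_m`-linear upgrade of `Φ` is
needed on the way to the witness. ORIGINAL RATIONALE (x9-p1 LEAD g3, FINDING S2-CITABLE 2026-08-28): on road R1 (port of Howard 2004 §2 at the Eisenstein prime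
`𝔮 = q_m = T^m + p`) the S2 input is Howard's ABSTRACT DVR Kolyvagin bound, Compositio 140 (2004) Thm. 1.6.1 (arXiv
Thm. 2.6.1) applied — as his Prop. 2.1.3 (arXiv 3.1.3) does — to the specialised Selmer triple `(T_𝔮, 𝓕_𝔮, 𝓛)` over
the DVR `S_𝔮 = Λ/𝔮` (tree: `IwasawaAlgebra.isDiscreteValuationRing_quotient_X_pow_add_C`). Its PRINTED output is
«`H¹_𝓕(K, T_𝔮)` is a free rank-one `S_𝔮`-module, `H¹_𝓕(K, A_𝔮) ≅ 𝒟_𝔮 ⊕ M_𝔮 ⊕ M_𝔮` with `M_𝔮` finite and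
`len(M_𝔮) ≤ len(H¹_𝓕(K, T_𝔮)/S_𝔮·κ₁)`», where `𝒟_𝔮 = Φ_𝔮/S_𝔮` is a DIVISIBLE group. The witness interface wants the
dual side as `Xq` with `#(Xq)_tors ≤ #(H/κ₁)²`; the intended `Xq` is the Pontryagin dual `Hom(H¹_𝓕(K, A_𝔮), ℚ/ℤ)`
(the target of the dual control map `𝒳/q_m𝒳 → Xq`, Howard Lemma 2.2.7 / arXiv 3.2.7, second map, dualised).

WHAT. `nonempty_specWitness_of_howardShape_addEquiv`: GIVEN the S1 control data exactly as in
`nonempty_specWitness_of_dvrData` (`f : 𝔖 → H` with `#coker ≤ c`, `κ₁` with `f(Λκ_∞(C)) ⊆ Λκ₁`, `h : 𝒳/q_m𝒳 → Xq`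
with `#ker ≤ c`) and S2 in the printed shape — `e : H ≃ₗ[S_m] S_m`, `κ₁ ≠ 0`, ANY additive identification
`Xq ≃+ Hom(B, ℚ/ℤ)` of the `Λ`-module `Xq` with the character group of a group `B ≃+ D × (M × M)` with `D` divisible
and `M` a finite `S_m`-module with `len M ≤ len(H/S_m·κ₁)` — THEN `Nonempty (SpecWitness Λ 𝔖 𝒳 Λκ_∞(C) q_m c)`.
NO finite generation of `Xq` over `S_m` is required (so no `S_𝔮^∨ ≅ S_𝔮` / trace-form input): the torsion of
`Hom(D × (M × M), ℚ/ℤ)` is `Hom(M × M, ℚ/ℤ)` (`PontryaginCard.natCard_torsion_characterModule`: the dual of a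
divisible group is torsion-free, the dual of a finite group is torsion), of cardinality `#M² = p^{2 len M}`.
Companions: `…_addEquiv_of_finrank_eq_one` (S2's first clause as `Module.Free` + `finrank = 1`), `nonempty_specWitness_of_torsionDual`
(dual side given only through `(Xq)_tors ≃+ Hom(M × M, ℚ/ℤ)`), and the bookkeeping lemma
`natCard_torsion_le_sq_of_howardShape_addEquiv` (the field `card_torsion_le_sq` alone). For the S1 side of `h`, the tree
already has Tate's Lemma z.3 BY NAME (`natCard_ker_dual`, `finite_ker_dual_iff` in
`Literature/NumberTheory/EllipticCurves/FunctionFieldBSDTateLemmaZ3Proofs`): the kernel of the dual of a map with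
finite cokernel is finite of the same cardinality.
HONEST FRAMING: nothing here constructs `f`, `h`, `e`, `B`, `M`; «beyond-print theorem»: no. BSD is not proved by any of
this; no summit statement is proved by this seat.

References: [Howard2004HeegnerKolyvagin] Thm. 1.6.1, Prop. 2.1.3, Lemma 2.2.7, proof of Thm. 2.2.10 (𝔮 = T^m + p);
[MastellaZerman2026] Thm. 2.40.
-/

set_option linter.dupNamespace false
set_option autoImplicit false

noncomputable section

open scoped Classical Pointwise

open Literature Literature.NumberTheory.EllipticCurves WeierstrassCurve

namespace Summit.BirchSwinnertonDyer.BirchSwinnertonDyer.Theorems.HeegnerMuPartStabilized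

/-- **S2 bookkeeping in Howard's printed shape**: if `Xq ≃+ Hom(B, ℚ/ℤ)` with `B ≃+ D × (M × M)`, `D` divisible,
`M` a finite `S_m`-module with `len M ≤ len(H ⧸ S_m∙κ₁)`, and `H ⧸ S_m∙κ₁` is finite, then `(Xq)_tors` is finite and
`#(Xq)_tors ≤ #(H ⧸ S_m∙κ₁)²` (`#(Xq)_tors = #M²`, `#M = p^{len M} ≤ p^{len(H/κ₁)} = #(H ⧸ S_m∙κ₁)` by
`IwasawaAlgebra.natCard_le_pow_of_length_le_mul`).
[cite: Howard2004HeegnerKolyvagin, Thm. 1.6.1] [cite: MastellaZerman2026, Thm. 2.40] -/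
theorem natCard_torsion_le_sq_of_howardShape_addEquiv {p : ℕ} [hp : Fact p.Prime] {m : ℕ} (hm : 1 ≤ m)
    {H : Type} [AddCommGroup H]
    [Module (IwasawaAlgebra p ⧸
      Ideal.span {(PowerSeries.X ^ m + PowerSeries.C (p : ℤ_[p]) : IwasawaAlgebra p)}) H]
    (κ₁ : H)
    (hfin : Finite (H ⧸ Submodule.span (IwasawaAlgebra p ⧸
      Ideal.span {(PowerSeries.X ^ m + PowerSeries.C (p : ℤ_[p]) : IwasawaAlgebra p)}) {κ₁}))
    {Xq : Type} [AddCommGroup Xq]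
    {B D M : Type} [AddCommGroup B] [AddCommGroup D] [AddCommGroup M]
    [Module (IwasawaAlgebra p ⧸
      Ideal.span {(PowerSeries.X ^ m + PowerSeries.C (p : ℤ_[p]) : IwasawaAlgebra p)}) M] [Finite M]
    (eX : Xq ≃+ CharacterModule B) (eB : B ≃+ D × (M × M))
    (hD : ∀ n : ℕ, n ≠ 0 → ∀ d : D, ∃ d' : D, n • d' = d)
    (hM : Module.length (IwasawaAlgebra p ⧸
        Ideal.span {(PowerSeries.X ^ m + PowerSeries.C (p : ℤ_[p]) : IwasawaAlgebra p)}) M ≤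
      Module.length (IwasawaAlgebra p ⧸
        Ideal.span {(PowerSeries.X ^ m + PowerSeries.C (p : ℤ_[p]) : IwasawaAlgebra p)})
        (H ⧸ Submodule.span (IwasawaAlgebra p ⧸
          Ideal.span {(PowerSeries.X ^ m + PowerSeries.C (p : ℤ_[p]) : IwasawaAlgebra p)}) {κ₁})) :
    Finite (AddCommGroup.torsion Xq) ∧
      Nat.card (AddCommGroup.torsion Xq) ≤ Nat.card (H ⧸ Submodule.span (IwasawaAlgebra p ⧸
        Ideal.span {(PowerSeries.X ^ m + PowerSeries.C (p : ℤ_[p]) : IwasawaAlgebra p)}) {κ₁}) ^ 2 := by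
  have hfinT : Finite (AddCommGroup.torsion Xq) :=
    (PontryaginCard.finite_torsion_congr eX).mpr (PontryaginCard.finite_torsion_characterModule eB hD)
  have hcardT : Nat.card (AddCommGroup.torsion Xq) = Nat.card M ^ 2 := by
    rw [PontryaginCard.natCard_torsion_congr eX, PontryaginCard.natCard_torsion_characterModule eB hD,
      Nat.card_prod, sq]
  haveI := hfin
  have hMle : Nat.card M ≤ Nat.card (H ⧸ Submodule.span (IwasawaAlgebra p ⧸
      Ideal.span {(PowerSeries.X ^ m + PowerSeries.C (p : ℤ_[p]) : IwasawaAlgebra p)}) {κ₁}) := by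
    have h1 := IwasawaAlgebra.natCard_le_pow_of_length_le_mul p hm (N := M)
      (N' := H ⧸ Submodule.span (IwasawaAlgebra p ⧸
        Ideal.span {(PowerSeries.X ^ m + PowerSeries.C (p : ℤ_[p]) : IwasawaAlgebra p)}) {κ₁}) 1
      (by rw [Nat.cast_one, one_mul]; exact hM)
    rwa [pow_one] at h1
  exact ⟨hfinT, hcardT ▸ Nat.pow_le_pow_left hMle 2⟩

/-- **A `SpecWitness` at `q_m` from S1 (control) and S2 in Howard's printed shape, through the Pontryagin dual.**
See the module docstring. Conversions used: `q_m • H = 0` from the scalar tower; `#(H ⧸ Λ∙κ₁) = #(H ⧸ S_m∙κ₁)`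
(`Submodule.restrictScalars_span`), finite by `IwasawaAlgebra.finite_quotient_span_singleton_of_linearEquiv`;
the torsion count `natCard_torsion_le_sq_of_howardShape`.
[cite: Howard2004HeegnerKolyvagin, Thm. 1.6.1, Prop. 2.1.3 and proof of Thm. 2.2.10 (𝔮 = T^m + p)]
[cite: MastellaZerman2026, Thm. 2.40] -/
theorem nonempty_specWitness_of_howardShape_addEquiv {p : ℕ} [hp : Fact p.Prime] {m : ℕ} (hm : 1 ≤ m)
    {S X : Type} [AddCommGroup S] [Module (IwasawaAlgebra p) S] [AddCommGroup X] [Module (IwasawaAlgebra p) X]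
    (L : Submodule (IwasawaAlgebra p) S)
    {H : Type} [AddCommGroup H] [Module (IwasawaAlgebra p) H]
    [Module (IwasawaAlgebra p ⧸
      Ideal.span {(PowerSeries.X ^ m + PowerSeries.C (p : ℤ_[p]) : IwasawaAlgebra p)}) H]
    [IsScalarTower (IwasawaAlgebra p) (IwasawaAlgebra p ⧸
      Ideal.span {(PowerSeries.X ^ m + PowerSeries.C (p : ℤ_[p]) : IwasawaAlgebra p)}) H]
    {Xq : Type} [AddCommGroup Xq] [Module (IwasawaAlgebra p) Xq]
    -- S1: control
    (f : S →ₗ[IwasawaAlgebra p] H) (κ₁ : H) (hL : L.map f ≤ (IwasawaAlgebra p) ∙ κ₁) (c : ℕ)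
    (hcoker : Finite (H ⧸ LinearMap.range f)) (hcoker_le : Nat.card (H ⧸ LinearMap.range f) ≤ c)
    (h : (X ⧸ ((Ideal.span {(PowerSeries.X ^ m + PowerSeries.C (p : ℤ_[p]) : IwasawaAlgebra p)} :
        Ideal (IwasawaAlgebra p)) • (⊤ : Submodule (IwasawaAlgebra p) X))) →ₗ[IwasawaAlgebra p] Xq)
    (hker : Finite (LinearMap.ker h)) (hker_le : Nat.card (LinearMap.ker h) ≤ c)
    -- S2: Howard's printed shape
    (e : H ≃ₗ[IwasawaAlgebra p ⧸
      Ideal.span {(PowerSeries.X ^ m + PowerSeries.C (p : ℤ_[p]) : IwasawaAlgebra p)}]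
      (IwasawaAlgebra p ⧸ Ideal.span {(PowerSeries.X ^ m + PowerSeries.C (p : ℤ_[p]) : IwasawaAlgebra p)}))
    (hκ : κ₁ ≠ 0)
    {B D M : Type} [AddCommGroup B] [AddCommGroup D] [AddCommGroup M]
    [Module (IwasawaAlgebra p ⧸
      Ideal.span {(PowerSeries.X ^ m + PowerSeries.C (p : ℤ_[p]) : IwasawaAlgebra p)}) M] [Finite M]
    (eX : Xq ≃+ CharacterModule B) (eB : B ≃+ D × (M × M))
    (hD : ∀ n : ℕ, n ≠ 0 → ∀ d : D, ∃ d' : D, n • d' = d)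
    (hM : Module.length (IwasawaAlgebra p ⧸
        Ideal.span {(PowerSeries.X ^ m + PowerSeries.C (p : ℤ_[p]) : IwasawaAlgebra p)}) M ≤
      Module.length (IwasawaAlgebra p ⧸
        Ideal.span {(PowerSeries.X ^ m + PowerSeries.C (p : ℤ_[p]) : IwasawaAlgebra p)})
        (H ⧸ Submodule.span (IwasawaAlgebra p ⧸
          Ideal.span {(PowerSeries.X ^ m + PowerSeries.C (p : ℤ_[p]) : IwasawaAlgebra p)}) {κ₁})) :
    Nonempty (SpecWitness (IwasawaAlgebra p) S X L
      (PowerSeries.X ^ m + PowerSeries.C (p : ℤ_[p]) : IwasawaAlgebra p) c) := by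
  -- (0) `q_m` kills `H`
  have hsmul : (Ideal.span {(PowerSeries.X ^ m + PowerSeries.C (p : ℤ_[p]) : IwasawaAlgebra p)} :
      Ideal (IwasawaAlgebra p)) • (⊤ : Submodule (IwasawaAlgebra p) H) = ⊥ := by
    rw [Submodule.ideal_span_singleton_smul, eq_bot_iff]
    intro y hy
    obtain ⟨x, -, rfl⟩ := (Submodule.mem_smul_pointwise_iff_exists y _ ⊤).1 hy
    rw [Submodule.mem_bot, ← IsScalarTower.algebraMap_smul (IwasawaAlgebra p ⧸
      Ideal.span {(PowerSeries.X ^ m + PowerSeries.C (p : ℤ_[p]) : IwasawaAlgebra p)}),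
      Ideal.Quotient.algebraMap_eq,
      Ideal.Quotient.eq_zero_iff_mem.mpr (Ideal.mem_span_singleton_self _)]
    exact zero_smul (IwasawaAlgebra p ⧸
      Ideal.span {(PowerSeries.X ^ m + PowerSeries.C (p : ℤ_[p]) : IwasawaAlgebra p)}) x
  -- (1) `H ⧸ S_m∙κ₁` is finite and has the same cardinality as `H ⧸ Λ∙κ₁`
  have hfinQuotS := IwasawaAlgebra.finite_quotient_span_singleton_of_linearEquiv p hm e κ₁ hκ
  have hspan : (Submodule.span (IwasawaAlgebra p ⧸
      Ideal.span {(PowerSeries.X ^ m + PowerSeries.C (p : ℤ_[p]) : IwasawaAlgebra p)}) {κ₁}).restrictScalars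
        (IwasawaAlgebra p) = (IwasawaAlgebra p) ∙ κ₁ :=
    Submodule.restrictScalars_span (IwasawaAlgebra p) (IwasawaAlgebra p ⧸
      Ideal.span {(PowerSeries.X ^ m + PowerSeries.C (p : ℤ_[p]) : IwasawaAlgebra p)})
      Ideal.Quotient.mk_surjective {κ₁}
  have eQ : (H ⧸ ((IwasawaAlgebra p) ∙ κ₁)) ≃ (H ⧸ Submodule.span (IwasawaAlgebra p ⧸
      Ideal.span {(PowerSeries.X ^ m + PowerSeries.C (p : ℤ_[p]) : IwasawaAlgebra p)}) {κ₁}) :=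
    ((Submodule.quotEquivOfEq _ _ hspan.symm).trans
      (Submodule.Quotient.restrictScalarsEquiv (IwasawaAlgebra p) _)).toEquiv
  have hfinQuot : Finite (H ⧸ ((IwasawaAlgebra p) ∙ κ₁)) := Finite.of_equiv _ eQ.symm
  -- (2) the torsion count through the Pontryagin dual
  obtain ⟨hfinT, hcardT⟩ := natCard_torsion_le_sq_of_howardShape_addEquiv hm κ₁ hfinQuotS eX eB hD hM
  refine ⟨SpecWitness.mk (H := H) (Xq := Xq) (κ₁ := κ₁) (f := f) (h := h) (smul_top_eq_bot := hsmul)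
    (map_le := hL) (finite_coker := hcoker) (card_coker_le := hcoker_le) (finite_ker := hker)
    (card_ker_le := hker_le) (finite_torsion := hfinT) (finite_quot := hfinQuot)
    (card_torsion_le_sq := ?_)⟩
  rw [Nat.card_congr eQ]
  exact hcardT

/-- **Variant: S2's first clause in the basis-free form «`H¹_𝓕(K, T_𝔮)` is free of rank one»** (`Module.Free`,
`Module.Finite`, `finrank = 1` over the domain `S_m`), converted to `e : H ≃ₗ[S_m] S_m` by `LinearEquiv.ofFinrankEq`.
[cite: Howard2004HeegnerKolyvagin, Thm. 1.6.1 and Prop. 2.1.3] [cite: MastellaZerman2026, Thm. 2.40] -/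
theorem nonempty_specWitness_of_howardShape_addEquiv_of_finrank_eq_one {p : ℕ} [hp : Fact p.Prime] {m : ℕ} (hm : 1 ≤ m)
    {S X : Type} [AddCommGroup S] [Module (IwasawaAlgebra p) S] [AddCommGroup X] [Module (IwasawaAlgebra p) X]
    (L : Submodule (IwasawaAlgebra p) S)
    {H : Type} [AddCommGroup H] [Module (IwasawaAlgebra p) H]
    [Module (IwasawaAlgebra p ⧸
      Ideal.span {(PowerSeries.X ^ m + PowerSeries.C (p : ℤ_[p]) : IwasawaAlgebra p)}) H]
    [IsScalarTower (IwasawaAlgebra p) (IwasawaAlgebra p ⧸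
      Ideal.span {(PowerSeries.X ^ m + PowerSeries.C (p : ℤ_[p]) : IwasawaAlgebra p)}) H]
    [Module.Free (IwasawaAlgebra p ⧸
      Ideal.span {(PowerSeries.X ^ m + PowerSeries.C (p : ℤ_[p]) : IwasawaAlgebra p)}) H]
    [Module.Finite (IwasawaAlgebra p ⧸
      Ideal.span {(PowerSeries.X ^ m + PowerSeries.C (p : ℤ_[p]) : IwasawaAlgebra p)}) H]
    {Xq : Type} [AddCommGroup Xq] [Module (IwasawaAlgebra p) Xq]
    -- S1: control
    (f : S →ₗ[IwasawaAlgebra p] H) (κ₁ : H) (hL : L.map f ≤ (IwasawaAlgebra p) ∙ κ₁) (c : ℕ)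
    (hcoker : Finite (H ⧸ LinearMap.range f)) (hcoker_le : Nat.card (H ⧸ LinearMap.range f) ≤ c)
    (h : (X ⧸ ((Ideal.span {(PowerSeries.X ^ m + PowerSeries.C (p : ℤ_[p]) : IwasawaAlgebra p)} :
        Ideal (IwasawaAlgebra p)) • (⊤ : Submodule (IwasawaAlgebra p) X))) →ₗ[IwasawaAlgebra p] Xq)
    (hker : Finite (LinearMap.ker h)) (hker_le : Nat.card (LinearMap.ker h) ≤ c)
    -- S2: Howard's printed shape, basis-free first clause
    (hH : Module.finrank (IwasawaAlgebra p ⧸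
      Ideal.span {(PowerSeries.X ^ m + PowerSeries.C (p : ℤ_[p]) : IwasawaAlgebra p)}) H = 1)
    (hκ : κ₁ ≠ 0)
    {B D M : Type} [AddCommGroup B] [AddCommGroup D] [AddCommGroup M]
    [Module (IwasawaAlgebra p ⧸
      Ideal.span {(PowerSeries.X ^ m + PowerSeries.C (p : ℤ_[p]) : IwasawaAlgebra p)}) M] [Finite M]
    (eX : Xq ≃+ CharacterModule B) (eB : B ≃+ D × (M × M))
    (hD : ∀ n : ℕ, n ≠ 0 → ∀ d : D, ∃ d' : D, n • d' = d)
    (hM : Module.length (IwasawaAlgebra p ⧸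
        Ideal.span {(PowerSeries.X ^ m + PowerSeries.C (p : ℤ_[p]) : IwasawaAlgebra p)}) M ≤
      Module.length (IwasawaAlgebra p ⧸
        Ideal.span {(PowerSeries.X ^ m + PowerSeries.C (p : ℤ_[p]) : IwasawaAlgebra p)})
        (H ⧸ Submodule.span (IwasawaAlgebra p ⧸
          Ideal.span {(PowerSeries.X ^ m + PowerSeries.C (p : ℤ_[p]) : IwasawaAlgebra p)}) {κ₁})) :
    Nonempty (SpecWitness (IwasawaAlgebra p) S X L
      (PowerSeries.X ^ m + PowerSeries.C (p : ℤ_[p]) : IwasawaAlgebra p) c) := by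
  haveI := IwasawaAlgebra.isDomain_quotient_X_pow_add_C p hm
  have e : H ≃ₗ[IwasawaAlgebra p ⧸
      Ideal.span {(PowerSeries.X ^ m + PowerSeries.C (p : ℤ_[p]) : IwasawaAlgebra p)}]
      (IwasawaAlgebra p ⧸ Ideal.span {(PowerSeries.X ^ m + PowerSeries.C (p : ℤ_[p]) : IwasawaAlgebra p)}) :=
    LinearEquiv.ofFinrankEq H _ (by rw [hH, Module.finrank_self])
  exact nonempty_specWitness_of_howardShape_addEquiv hm L f κ₁ hL c hcoker hcoker_le h hker hker_le e hκ eX eB hD hM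

/-- **Variant: the dual side given only through its torsion** — «the torsion subgroup of `Xq` is dual to
`B/B_div ≅ M × M`» (Greenberg's phrasing, LNM 1716 §4 p. 98), i.e. an additive identification
`(Xq)_tors ≃+ Hom(M × M, ℚ/ℤ)`, with `M` a finite `S_m`-module, `len M ≤ len(H ⧸ S_m∙κ₁)`.
[cite: Howard2004HeegnerKolyvagin, Thm. 1.6.1] [cite: GreenbergLNM1716, §4 p. 98] -/
theorem nonempty_specWitness_of_torsionDual {p : ℕ} [hp : Fact p.Prime] {m : ℕ} (hm : 1 ≤ m)
    {S X : Type} [AddCommGroup S] [Module (IwasawaAlgebra p) S] [AddCommGroup X] [Module (IwasawaAlgebra p) X]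
    (L : Submodule (IwasawaAlgebra p) S)
    {H : Type} [AddCommGroup H] [Module (IwasawaAlgebra p) H]
    [Module (IwasawaAlgebra p ⧸
      Ideal.span {(PowerSeries.X ^ m + PowerSeries.C (p : ℤ_[p]) : IwasawaAlgebra p)}) H]
    [IsScalarTower (IwasawaAlgebra p) (IwasawaAlgebra p ⧸
      Ideal.span {(PowerSeries.X ^ m + PowerSeries.C (p : ℤ_[p]) : IwasawaAlgebra p)}) H]
    {Xq : Type} [AddCommGroup Xq] [Module (IwasawaAlgebra p) Xq]
    -- S1: control
    (f : S →ₗ[IwasawaAlgebra p] H) (κ₁ : H) (hL : L.map f ≤ (IwasawaAlgebra p) ∙ κ₁) (c : ℕ)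
    (hcoker : Finite (H ⧸ LinearMap.range f)) (hcoker_le : Nat.card (H ⧸ LinearMap.range f) ≤ c)
    (h : (X ⧸ ((Ideal.span {(PowerSeries.X ^ m + PowerSeries.C (p : ℤ_[p]) : IwasawaAlgebra p)} :
        Ideal (IwasawaAlgebra p)) • (⊤ : Submodule (IwasawaAlgebra p) X))) →ₗ[IwasawaAlgebra p] Xq)
    (hker : Finite (LinearMap.ker h)) (hker_le : Nat.card (LinearMap.ker h) ≤ c)
    -- S2
    (e : H ≃ₗ[IwasawaAlgebra p ⧸
      Ideal.span {(PowerSeries.X ^ m + PowerSeries.C (p : ℤ_[p]) : IwasawaAlgebra p)}]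
      (IwasawaAlgebra p ⧸ Ideal.span {(PowerSeries.X ^ m + PowerSeries.C (p : ℤ_[p]) : IwasawaAlgebra p)}))
    (hκ : κ₁ ≠ 0)
    {M : Type} [AddCommGroup M]
    [Module (IwasawaAlgebra p ⧸
      Ideal.span {(PowerSeries.X ^ m + PowerSeries.C (p : ℤ_[p]) : IwasawaAlgebra p)}) M] [Finite M]
    (eT : AddCommGroup.torsion Xq ≃+ CharacterModule (M × M))
    (hM : Module.length (IwasawaAlgebra p ⧸
        Ideal.span {(PowerSeries.X ^ m + PowerSeries.C (p : ℤ_[p]) : IwasawaAlgebra p)}) M ≤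
      Module.length (IwasawaAlgebra p ⧸
        Ideal.span {(PowerSeries.X ^ m + PowerSeries.C (p : ℤ_[p]) : IwasawaAlgebra p)})
        (H ⧸ Submodule.span (IwasawaAlgebra p ⧸
          Ideal.span {(PowerSeries.X ^ m + PowerSeries.C (p : ℤ_[p]) : IwasawaAlgebra p)}) {κ₁})) :
    Nonempty (SpecWitness (IwasawaAlgebra p) S X L
      (PowerSeries.X ^ m + PowerSeries.C (p : ℤ_[p]) : IwasawaAlgebra p) c) := by
  -- (0) `q_m` kills `H`
  have hsmul : (Ideal.span {(PowerSeries.X ^ m + PowerSeries.C (p : ℤ_[p]) : IwasawaAlgebra p)} :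
      Ideal (IwasawaAlgebra p)) • (⊤ : Submodule (IwasawaAlgebra p) H) = ⊥ := by
    rw [Submodule.ideal_span_singleton_smul, eq_bot_iff]
    intro y hy
    obtain ⟨x, -, rfl⟩ := (Submodule.mem_smul_pointwise_iff_exists y _ ⊤).1 hy
    rw [Submodule.mem_bot, ← IsScalarTower.algebraMap_smul (IwasawaAlgebra p ⧸
      Ideal.span {(PowerSeries.X ^ m + PowerSeries.C (p : ℤ_[p]) : IwasawaAlgebra p)}),
      Ideal.Quotient.algebraMap_eq,
      Ideal.Quotient.eq_zero_iff_mem.mpr (Ideal.mem_span_singleton_self _)]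
    exact zero_smul (IwasawaAlgebra p ⧸
      Ideal.span {(PowerSeries.X ^ m + PowerSeries.C (p : ℤ_[p]) : IwasawaAlgebra p)}) x
  -- (1) `H ⧸ S_m∙κ₁` is finite and has the same cardinality as `H ⧸ Λ∙κ₁`
  have hfinQuotS := IwasawaAlgebra.finite_quotient_span_singleton_of_linearEquiv p hm e κ₁ hκ
  have hspan : (Submodule.span (IwasawaAlgebra p ⧸
      Ideal.span {(PowerSeries.X ^ m + PowerSeries.C (p : ℤ_[p]) : IwasawaAlgebra p)}) {κ₁}).restrictScalars
        (IwasawaAlgebra p) = (IwasawaAlgebra p) ∙ κ₁ :=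
    Submodule.restrictScalars_span (IwasawaAlgebra p) (IwasawaAlgebra p ⧸
      Ideal.span {(PowerSeries.X ^ m + PowerSeries.C (p : ℤ_[p]) : IwasawaAlgebra p)})
      Ideal.Quotient.mk_surjective {κ₁}
  have eQ : (H ⧸ ((IwasawaAlgebra p) ∙ κ₁)) ≃ (H ⧸ Submodule.span (IwasawaAlgebra p ⧸
      Ideal.span {(PowerSeries.X ^ m + PowerSeries.C (p : ℤ_[p]) : IwasawaAlgebra p)}) {κ₁}) :=
    ((Submodule.quotEquivOfEq _ _ hspan.symm).trans
      (Submodule.Quotient.restrictScalarsEquiv (IwasawaAlgebra p) _)).toEquiv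
  have hfinQuot : Finite (H ⧸ ((IwasawaAlgebra p) ∙ κ₁)) := Finite.of_equiv _ eQ.symm
  -- (2) the torsion count: `#(Xq)_tors = #Hom(M × M, ℚ/ℤ) = #M²`
  haveI := PontryaginCard.finite_characterModule_of_finite (M × M)
  have hfinT : Finite (AddCommGroup.torsion Xq) := Finite.of_equiv _ eT.toEquiv.symm
  have hcardT : Nat.card (AddCommGroup.torsion Xq) = Nat.card M ^ 2 := by
    rw [Nat.card_congr eT.toEquiv, PontryaginCard.natCard_characterModule, Nat.card_prod, sq]
  haveI := hfinQuotS
  have hMle : Nat.card M ≤ Nat.card (H ⧸ Submodule.span (IwasawaAlgebra p ⧸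
      Ideal.span {(PowerSeries.X ^ m + PowerSeries.C (p : ℤ_[p]) : IwasawaAlgebra p)}) {κ₁}) := by
    have h1 := IwasawaAlgebra.natCard_le_pow_of_length_le_mul p hm (N := M)
      (N' := H ⧸ Submodule.span (IwasawaAlgebra p ⧸
        Ideal.span {(PowerSeries.X ^ m + PowerSeries.C (p : ℤ_[p]) : IwasawaAlgebra p)}) {κ₁}) 1
      (by rw [Nat.cast_one, one_mul]; exact hM)
    rwa [pow_one] at h1
  refine ⟨SpecWitness.mk (H := H) (Xq := Xq) (κ₁ := κ₁) (f := f) (h := h) (smul_top_eq_bot := hsmul)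
    (map_le := hL) (finite_coker := hcoker) (card_coker_le := hcoker_le) (finite_ker := hker)
    (card_ker_le := hker_le) (finite_torsion := hfinT) (finite_quot := hfinQuot)
    (card_torsion_le_sq := ?_)⟩
  rw [Nat.card_congr eQ, hcardT]
  exact Nat.pow_le_pow_left hMle 2

end Summit.BirchSwinnertonDyer.BirchSwinnertonDyer.Theorems.HeegnerMuPartStabilized

end
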